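import Summits.QuantumFields.BalabanUV.Beta.EriceRemainderEnclosureHistoryAutonomyComparisonAgeCompositionYoungBelowCluster
import Summits.QuantumFields.BalabanUV.Beta.EriceRemainderEnclosureHistoryAutonomyComparisonAgeCompositionChainShares

/-!
# EriceRemainderEnclosureHistoryAutonomyComparisonAgeCompositionPairShares — (E92b) route (N), first order: THE PAIR LOAD BOUND IN THE PRESENCE OF OTHER
# AGES, AND THE WEDGES R1∕R2 OF (E91c) DISCHARGED.  Along every admissible flow, for ANY profile and any two loaded ages `j < k`:
# `x_j(m) + x_k(m) ≤ √2∕(1 + c)` for every `0 ≤ c ≤ 1` with `c²·h(m+2j)h(m+2k) ≤ h(m+j+k)²` (the other ages only LOWER the two shares); the integer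
# chain of (E90d) supplies `c = P_{jk}` with `P⁴ = (j+1)∕(k+1)`, so `x_j + x_k ≤ √2∕(1 + p₀)` whenever `p₀⁴·(k+1) ≤ j+1`.  Hence the census three ages
# `{1, k₂, k₃}`: the END `0 ≤ ε ≤ e` along every flow (every horizon, every damping of the self-consistent class) for `10(1+p₀) ≤ (1+p₀−√2)k₂`,
# `p₀⁴(k₃+1) ≤ k₂+1` (wedge R1 with its load margin DISCHARGED; e.g. `k₃+1 ≤ 19(k₂+1)`, `k₂ ≥ 230`) and for `10k₂(1+p₀) ≤ (1+p₀−√2)k₃`,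
# `p₀⁴(k₂+1) ≤ 2` (wedge R2 discharged; `k₂ ≤ 66`)

Cell `pub-balaban`, β-function sub-cell, BINDER row D4 «RemainderConst leaves for Bałaban's split» (`HOME/BINDER-OWNERS.md`; owner lineage `b2b-balaban-beta-an4`;
this file by co-owner #2 lineage `b2b-balaban-beta-d4-p2`, generation 83), β-FLOW TEAM duty (1), FREEZE (0) honoured (def-free; nothing restated).

HONEST FRAMING (page 1, verbatim and binding).  *"Discharging BetaPertH makes Bałaban's UV stability UNCONDITIONAL — a real constructive-QFT result; it is
NOT the continuum limit and NOT the Clay problem."*  THIS FILE DISCHARGES NOTHING OF THE KIND.  Elementary real algebra ∕ real analysis about ABSTRACT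
functionals on a box ]0,γ]^ℕ with displayed floors, profiles and signs, and the FIRST-ORDER renewal objects of route (N) built from them — hypotheses of a
census, not facts; the form, signs, ages and moments of Bałaban's (1.22) limit functional are NOT PRINTED ([I] p. 298; GAPS G-t4-U2-1∕-2) and NOT asserted.
Row D4 class UNCHANGED (critical-path width 0; instance 0∕1; D4 DISCHARGE NO DATE).  HONEST DEPENDENCY: continuum YM on T⁴ ⇐ BetaPertH ∧ nine spine
estimates (0/9 proved); BetaPertH ⇐ (D1) ∧ (D4) ∧ CAP+tail; G-an2-4 gates asym, D1 and NE2/3/4.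

THE POINT (README `HOME/b2b-balaban-beta-d4-p2/g83/e92/README.md` §1–§2).  (E91c) typed the wedges R1 (`x₂ + x₃ ≤ 1 − δ`, `10 ≤ δk₂`) and R2
(`d + x₂ ≤ 1 − δ`, `10k₂ ≤ δk₃`) with the load margins DISPLAYED; (E90c)'s pair bound `x_i + x_j ≤ 1` is stated for a profile carried by the pair
alone.  Here the pair bound is re-derived INSIDE AN ARBITRARY PROFILE: each load is `≤ √2∕2` times its share of its own window ((E90b) `load_le_share`);
dropping the other ages from the two denominators only raises the shares, the two reduced shares lie on the hyperbola `(1−s)(1−s') = C²ss'` with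
`C² = h(m+j+k)²∕(h(m+2j)h(m+2k))` ((E90c) `share_hyperbola`), and (E90a) `two_shares_le` gives `(1+c)(s+s') ≤ 2` for every `c ≤ 1` with
`c² ≤ C²`; the integer chain `c = P = Π_{t∈[j−1,k−1)} ((t+2)∕(t+3))^{1∕4}` has `P⁴ = (j+1)∕(k+1)` and `P²·h(m+2j)h(m+2k) ≤ h(m+j+k)²` ((E90d)
`chain_kernel_le`).  Uses (E90b) `load_le_share`, (E90c) `share_hyperbola`, (E90a) `two_shares_le`, (E90d) `chain_kernel_le`∕`rho_facts`∕`prod_telescope`,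
(E89b) `window_load_le_sqrt_two_div_two`, (E91c) `flow_nonneg_three_ages_far_middle`∕`flow_nonneg_three_ages_far_old` BY NAME.  NOT CLAIMED: ratios
`(k₃+1)∕(k₂+1) > (1∕(√2−1))⁴ ≈ 34` for R1 (the pair bound exceeds `1` there) — those are (E92a)∕(E92c)'s nested wedge; `k₂ > 66` for R2; anything printed —
NOT B12 Thm 2, NOT BetaPertH.

WHAT IS PROVED ([folklore]; 0 `def`, 0 sorry).  §1 `two_terms_le_reads`, **`pair_load_le`**, `chain_const_facts`, **`pair_load_le_of_ratio`**.
§2 **`flow_nonneg_three_ages_middle_old`** (R1 discharged, parametric `p₀`), **`flow_nonneg_census_three_ages_ratio_le`** (`k₃+1 ≤ 19(k₂+1)`,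
`k₂ ≥ 230`), **`flow_nonneg_three_ages_young_pair`** (R2 discharged, parametric `p₀`).
-/
noncomputable section
open Finset

namespace Summit.QuantumFields.BalabanUV.Beta.EriceRemainderEnclosureHistoryAutonomyComparisonAgeCompositionPairShares

open Literature.MathematicalPhysics.QuantumFieldTheory.Balaban1983to89
open Literature.MathematicalPhysics.QuantumFieldTheory.Balaban1983to89.T4BetaStationary
open Literature.MathematicalPhysics.QuantumFieldTheory.Balaban1983to89.T4BetaFlowWellPosed
open Summit.QuantumFields.BalabanUV.Beta.EriceRemainderEnclosureHistoryAutonomyComparisonAgeCompositionThreeAgesMassCap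
  (window_load_le_sqrt_two_div_two)
open Summit.QuantumFields.BalabanUV.Beta.EriceRemainderEnclosureHistoryAutonomyComparisonAgeCompositionWindowShares (load_le_share)
open Summit.QuantumFields.BalabanUV.Beta.EriceRemainderEnclosureHistoryAutonomyComparisonAgeCompositionShareAlgebra (two_shares_le)
open Summit.QuantumFields.BalabanUV.Beta.EriceRemainderEnclosureHistoryAutonomyComparisonAgeCompositionThreeAgesTotalLoad (share_hyperbola)
open Summit.QuantumFields.BalabanUV.Beta.EriceRemainderEnclosureHistoryAutonomyComparisonAgeCompositionChainShares
  (rho_facts prod_telescope chain_kernel_le)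
open Summit.QuantumFields.BalabanUV.Beta.EriceRemainderEnclosureHistoryAutonomyComparisonAgeCompositionYoungBelowCluster
  (flow_nonneg_three_ages_far_middle flow_nonneg_three_ages_far_old)

variable {B : (ℕ → ℝ) → ℝ} {γ b gIR : ℝ} {L : ℕ → ℝ} {K : ℕ} {h g : ℕ → ℝ}

/-! ## §1 The pair load bound inside an arbitrary profile -/

/-- Two terms of the window reads: for distinct ages `j, k < K` and any pin `n`, `L_j·h(n+j) + L_k·h(n+k) ≤ Σ_{i<K} L_i·h(n+i)` (`L ≥ 0`, `h > 0`).
[folklore] -/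
theorem two_terms_le_reads (hL : ∀ k, 0 ≤ L k) (hh : SeqBox γ h) {j k : ℕ} (hjk : j ≠ k) (hjK : j < K) (hkK : k < K) (n : ℕ) :
    L j * h (n + j) + L k * h (n + k) ≤ ∑ i ∈ range K, L i * h (n + i) := by
  have hpos : ∀ n, 0 < h n := fun n => (hh n).1
  have hsub : ({j, k} : Finset ℕ) ⊆ range K := by
    intro x hx
    simp only [mem_insert, mem_singleton] at hx
    rw [mem_range]; rcases hx with rfl | rfl <;> assumption
  have := sum_le_sum_of_subset_of_nonneg hsub (f := fun i => L i * h (n + i)) fun i _ _ => mul_nonneg (hL i) (hpos _).le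
  rwa [sum_pair hjk] at this

/-- **THE PAIR LOAD BOUND IN THE PRESENCE OF OTHER AGES.**  `B` an isotone memory on the box with floor `b > 0` dominating the profile `L ≥ 0`
(any number of loaded ages), `h` a box solution; two ages `j < k < K`; any `0 ≤ c ≤ 1` with `c²·h(m+2j)·h(m+2k) ≤ h(m+j+k)²`.  Then
`x_j(m) + x_k(m) = j·L_jh(m+j)³∕2 + k·L_kh(m+k)³∕2 ≤ √2∕(1+c)` (load ≤ `√2∕2`·share, the other ages only lower the two shares, the reduced shares
lie on the hyperbola `(1−s)(1−s') = C²ss'` with `c ≤ C`, and `(1+c)(s+s') ≤ 2`). [folklore] -/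
theorem pair_load_le (hmono : ∀ u v : ℕ → ℝ, SeqBox γ u → SeqBox γ v → (∀ j, u j ≤ v j) → B u ≤ B v)
    (hL : ∀ k, 0 ≤ L k) (hb : 0 < b) (hlo : ∀ u, SeqBox γ u → b ≤ B u) (hdom : ∀ u, SeqBox γ u → ∑ k ∈ range K, L k * u k ≤ B u)
    (hh : SeqBox γ h) (hf : MemFlow B gIR h) {j k : ℕ} (hjk : j < k) (hkK : k < K) (m : ℕ) {c : ℝ} (hc0 : 0 ≤ c) (hc1 : c ≤ 1)
    (hc : c ^ 2 * (h (m + 2 * j) * h (m + 2 * k)) ≤ h (m + j + k) ^ 2) :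
    (j : ℝ) * (L j * h (m + j) ^ 3 / 2) + (k : ℝ) * (L k * h (m + k) ^ 3 / 2) ≤ Real.sqrt 2 / (1 + c) := by
  have hpos : ∀ n, 0 < h n := fun n => (hh n).1
  have hjK : j < K := lt_trans hjk hkK
  have hs0 : 0 ≤ Real.sqrt 2 := Real.sqrt_nonneg 2
  have hc1' : 0 < 1 + c := by linarith
  have hxj := load_le_share hmono hL hb hlo hdom hh hf hjK m
  have hxk := load_le_share hmono hL hb hlo hdom hh hf hkK m
  have hxj2 := window_load_le_sqrt_two_div_two hmono hL hb hlo hdom hh hf hjK m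
  have hxk2 := window_load_le_sqrt_two_div_two hmono hL hb hlo hdom hh hf hkK m
  -- √2∕2 ≤ √2∕(1+c)
  have hhalf : Real.sqrt 2 / 2 ≤ Real.sqrt 2 / (1 + c) := div_le_div_of_nonneg_left hs0 hc1' (by linarith)
  -- degenerate profiles: one of the two ages unloaded
  rcases (hL j).eq_or_lt with hLj | hLj
  · rw [← hLj]; simp only [zero_mul, zero_div, mul_zero, zero_add]; exact hxk2.trans hhalf
  rcases (hL k).eq_or_lt with hLk | hLk
  · rw [← hLk]; simp only [zero_mul, zero_div, mul_zero, add_zero]; exact hxj2.trans hhalf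
  -- the levels and the reduced shares
  have hp := hpos (m + 2 * j); have hq := hpos (m + j + k); have hr := hpos (m + 2 * k)
  have hD1 : 0 < L j * h (m + 2 * j) + L k * h (m + j + k) := by positivity
  have hD2 : 0 < L j * h (m + j + k) + L k * h (m + 2 * k) := by positivity
  -- the other ages only lower the shares: the two reduced denominators are below the full window reads
  have hDj : L j * h (m + 2 * j) + L k * h (m + j + k) ≤ ∑ i ∈ range K, L i * h (m + j + i) := by
    have := two_terms_le_reads hL hh hjk.ne hjK hkK (m + j)
    rwa [show m + j + j = m + 2 * j by ring] at this
  have hDk : L j * h (m + j + k) + L k * h (m + 2 * k) ≤ ∑ i ∈ range K, L i * h (m + k + i) := by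
    have := two_terms_le_reads hL hh hjk.ne hjK hkK (m + k)
    rwa [show m + k + j = m + j + k by ring, show m + k + k = m + 2 * k by ring] at this
  set s := L j * h (m + 2 * j) / (L j * h (m + 2 * j) + L k * h (m + j + k)) with hs_def
  set s' := L k * h (m + 2 * k) / (L j * h (m + j + k) + L k * h (m + 2 * k)) with hs'_def
  have hsj : L j * h (m + 2 * j) / ∑ i ∈ range K, L i * h (m + j + i) ≤ s :=
    div_le_div_of_nonneg_left (by positivity) hD1 hDj
  have hsk : L k * h (m + 2 * k) / ∑ i ∈ range K, L i * h (m + k + i) ≤ s' :=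
    div_le_div_of_nonneg_left (by positivity) hD2 hDk
  have hsn : 0 ≤ s := by positivity
  have hsn' : 0 ≤ s' := by positivity
  have hs1 : s ≤ 1 := div_le_one_of_le₀ (by nlinarith [mul_pos hLk hq]) hD1.le
  have hs1' : s' ≤ 1 := div_le_one_of_le₀ (by nlinarith [mul_pos hLj hq]) hD2.le
  -- the hyperbola and the comparison c² ≤ C² = q²∕(pr)
  have hhyp := share_hyperbola (a := L j) (c := L k) hp hr hD1 hD2
  have hC : c ^ 2 ≤ h (m + j + k) ^ 2 / (h (m + 2 * j) * h (m + 2 * k)) := by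
    rw [le_div_iff₀ (mul_pos hp hr)]; exact hc
  have hXY : c ^ 2 * (s * s') ≤ (1 - s) * (1 - s') := by
    rw [hs_def, hs'_def, hhyp]
    exact mul_le_mul_of_nonneg_right hC (mul_nonneg hsn hsn')
  have htwo := two_shares_le hc0 hc1 hs1 hs1' hXY
  -- assemble: x_j + x_k ≤ (√2∕2)(s + s') ≤ √2∕(1+c)
  have h1 : (j : ℝ) * (L j * h (m + j) ^ 3 / 2) ≤ Real.sqrt 2 / 2 * s := hxj.trans (mul_le_mul_of_nonneg_left hsj (by positivity))
  have h2 : (k : ℝ) * (L k * h (m + k) ^ 3 / 2) ≤ Real.sqrt 2 / 2 * s' := hxk.trans (mul_le_mul_of_nonneg_left hsk (by positivity))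
  rw [le_div_iff₀ hc1']
  have h3 : Real.sqrt 2 / 2 * (s + s') * (1 + c) ≤ Real.sqrt 2 := by
    have := mul_le_mul_of_nonneg_left htwo (show 0 ≤ Real.sqrt 2 / 2 by positivity)
    linarith
  have h4 := mul_le_mul_of_nonneg_right (add_le_add h1 h2) hc1'.le
  linarith [h3, h4]

/-- **THE INTEGER CHAIN CONSTANT OF A PAIR OF AGES.**  For positions `a ≤ b` (ages `a+1 ≤ b+1`) along every flow, the chain product
`P = Π_{t∈[a,b)} ((t+2)∕(t+3))^{1∕4}` satisfies `0 ≤ P ≤ 1`, `P⁴ = (a+2)∕(b+2)` and `P²·h(m+2a+2)·h(m+2b+2) ≤ h(m+a+b+2)²` ((E90d) `chain_kernel_le`,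
squared). [folklore] -/
theorem chain_const_facts (hmono : ∀ u v : ℕ → ℝ, SeqBox γ u → SeqBox γ v → (∀ j, u j ≤ v j) → B u ≤ B v) (hb : 0 < b)
    (hlo : ∀ u, SeqBox γ u → b ≤ B u) (hh : SeqBox γ h) (hf : MemFlow B gIR h) (m : ℕ) {a b' : ℕ} (hab : a ≤ b') :
    0 ≤ (∏ t ∈ Ico a b', Real.sqrt (Real.sqrt (((t : ℝ) + 2) / ((t : ℝ) + 3))))
    ∧ (∏ t ∈ Ico a b', Real.sqrt (Real.sqrt (((t : ℝ) + 2) / ((t : ℝ) + 3)))) ≤ 1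
    ∧ (∏ t ∈ Ico a b', Real.sqrt (Real.sqrt (((t : ℝ) + 2) / ((t : ℝ) + 3)))) ^ 4 = ((a : ℝ) + 2) / ((b' : ℝ) + 2)
    ∧ (∏ t ∈ Ico a b', Real.sqrt (Real.sqrt (((t : ℝ) + 2) / ((t : ℝ) + 3)))) ^ 2 * (h (m + 2 * (a + 1)) * h (m + 2 * (b' + 1)))
        ≤ h (m + (a + 1) + (b' + 1)) ^ 2 := by
  have hpos : ∀ n, 0 < h n := fun n => (hh n).1
  set P := ∏ t ∈ Ico a b', Real.sqrt (Real.sqrt (((t : ℝ) + 2) / ((t : ℝ) + 3))) with hP_def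
  have hP0 : 0 ≤ P := prod_nonneg fun t _ => Real.sqrt_nonneg _
  have hP1 : P ≤ 1 := prod_le_one (fun t _ => Real.sqrt_nonneg _) fun t _ => (rho_facts t).2.1.le
  have hP4 : P ^ 4 = ((a : ℝ) + 2) / ((b' : ℝ) + 2) := by
    rw [hP_def, ← prod_pow, prod_congr rfl fun t _ => (rho_facts t).2.2, prod_telescope hab]
  refine ⟨hP0, hP1, hP4, ?_⟩
  have hck := chain_kernel_le hmono hb hlo hh hf m hab
  have h1 := hpos (m + 2 * (a + 1)); have h2 := hpos (m + 2 * (b' + 1))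
  have hl0 : 0 ≤ P * (Real.sqrt (h (m + 2 * (a + 1))) * Real.sqrt (h (m + 2 * (b' + 1)))) := by positivity
  have hsq := pow_le_pow_left₀ hl0 hck 2
  rw [mul_pow, mul_pow, Real.sq_sqrt h1.le, Real.sq_sqrt h2.le] at hsq
  exact hsq

/-- **THE PAIR LOAD BOUND FROM THE RATIO OF THE AGES.**  Same memory, any profile; two ages `1 ≤ j < k < K` and `p₀ ≥ 0` with `p₀⁴·(k+1) ≤ j+1`.
Then `x_j(m) + x_k(m) ≤ √2∕(1 + p₀)` at every pin (`pair_load_le` with the integer chain constant, `P⁴ = (j+1)∕(k+1) ≥ p₀⁴`). [folklore] -/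
theorem pair_load_le_of_ratio (hmono : ∀ u v : ℕ → ℝ, SeqBox γ u → SeqBox γ v → (∀ j, u j ≤ v j) → B u ≤ B v)
    (hL : ∀ k, 0 ≤ L k) (hb : 0 < b) (hlo : ∀ u, SeqBox γ u → b ≤ B u) (hdom : ∀ u, SeqBox γ u → ∑ k ∈ range K, L k * u k ≤ B u)
    (hh : SeqBox γ h) (hf : MemFlow B gIR h) {j k : ℕ} (hj : 1 ≤ j) (hjk : j < k) (hkK : k < K) {p₀ : ℝ} (hp0 : 0 ≤ p₀)
    (hp : p₀ ^ 4 * ((k : ℝ) + 1) ≤ (j : ℝ) + 1) (m : ℕ) :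
    (j : ℝ) * (L j * h (m + j) ^ 3 / 2) + (k : ℝ) * (L k * h (m + k) ^ 3 / 2) ≤ Real.sqrt 2 / (1 + p₀) := by
  obtain ⟨a, rfl⟩ : ∃ a, j = a + 1 := ⟨j - 1, by omega⟩
  obtain ⟨b', rfl⟩ : ∃ b', k = b' + 1 := ⟨k - 1, by omega⟩
  have hab : a ≤ b' := by omega
  obtain ⟨hP0, hP1, hP4, hPsq⟩ := chain_const_facts hmono hb hlo hh hf m hab
  set P := ∏ t ∈ Ico a b', Real.sqrt (Real.sqrt (((t : ℝ) + 2) / ((t : ℝ) + 3))) with hP_def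
  -- p₀ ≤ P from p₀⁴ ≤ (a+2)∕(b'+2) = P⁴
  have hb2 : (0 : ℝ) < (b' : ℝ) + 2 := by positivity
  have hp4 : p₀ ^ 4 ≤ P ^ 4 := by
    rw [hP4, le_div_iff₀ hb2]
    push_cast at hp
    linarith
  have hpP : p₀ ≤ P := (pow_le_pow_iff_left₀ hp0 hP0 (by norm_num : (4 : ℕ) ≠ 0)).mp hp4
  have hmain := pair_load_le hmono hL hb hlo hdom hh hf (show a + 1 < b' + 1 by omega) hkK m hP0 hP1 hPsq
  exact hmain.trans (div_le_div_of_nonneg_left (Real.sqrt_nonneg 2) (by linarith) (by linarith))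

/-! ## §2 The wedges R1 and R2 of (E91c) with their load margins discharged -/

/-- **WEDGE R1 DISCHARGED: THE CENSUS THREE AGES WITH THE OLD PAIR NOT TOO FAR APART AND THE MIDDLE AGE OLD ENOUGH.**  Profile carried by
`{1, k₂, k₃}`, `2 ≤ k₂ < k₃ < K`; dampings of the self-consistent class `g_t(1+F_t) ≥ 1`; a parameter `p₀ ≥ 0` with `p₀⁴·(k₃+1) ≤ k₂+1` and
`10·(1+p₀) ≤ (1+p₀−√2)·k₂`.  Then `0 ≤ ε ≤ e` at every pin for every admissible excess and every horizon ((E91c) `flow_nonneg_three_ages_far_middle`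
with `δ = 1 − √2∕(1+p₀)`, its hypothesis `x₂ + x₃ ≤ 1 − δ` served by `pair_load_le_of_ratio`). [folklore] -/
theorem flow_nonneg_three_ages_middle_old (hmono : ∀ u v : ℕ → ℝ, SeqBox γ u → SeqBox γ v → (∀ j, u j ≤ v j) → B u ≤ B v)
    (hL : ∀ k, 0 ≤ L k) (hb : 0 < b) (hlo : ∀ u, SeqBox γ u → b ≤ B u) (hdom : ∀ u, SeqBox γ u → ∑ k ∈ range K, L k * u k ≤ B u)
    (hh : SeqBox γ h) (hf : MemFlow B gIR h) (hg : ∀ t, 0 < g t ∧ g t ≤ 1)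
    (hgF : ∀ t, 1 ≤ g t * (1 + ∑ k ∈ range K, L k * h (t + k) ^ 3 / 2))
    {k₂ k₃ : ℕ} (hk2 : 2 ≤ k₂) (hk23 : k₂ < k₃) (hk3K : k₃ < K) (hL3 : ∀ j, j < K → j ≠ 1 → j ≠ k₂ → j ≠ k₃ → L j = 0)
    {p₀ : ℝ} (hp0 : 0 ≤ p₀) (hp : p₀ ^ 4 * ((k₃ : ℝ) + 1) ≤ (k₂ : ℝ) + 1)
    (hfar : 10 * (1 + p₀) ≤ (1 + p₀ - Real.sqrt 2) * k₂)
    {N : ℕ} {KL : ℕ → ℕ → ℕ → ℝ}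
    (hKL : ∀ k n l, KL k n l = if 0 < k ∧ k < K ∧ l < k then L k * h (n + k) ^ 3 / 2 * ∏ t ∈ Ico (n + 1 + l) (n + k + 1), g t else 0)
    {KA : ℕ → ℕ → ℕ → ℝ} {RA : ℕ → (ℕ → ℝ) → ℕ → ℝ}
    (hRA : ∀ i v m, RA i v m = ∑ l ∈ range K, KA i m l * v (m + 1 + l))
    (hKA : ∀ i m l, KA i m l = KL i m l + KA (i + 1) m l) (hKAtop : ∀ m l, KA K m l = 0)
    {e ε : ℕ → ℝ} (he0 : ∀ m, 0 ≤ e m) (hea : ∀ m, e (m + 1) ≤ e m)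
    (hεt : ∀ m, N < m → ε m = 0) (hεrec : ∀ m, ε m = e m - RA 1 ε m) : ∀ m, 0 ≤ ε m ∧ ε m ≤ e m := by
  have hs0 : 0 ≤ Real.sqrt 2 := Real.sqrt_nonneg 2
  have hk2r : (0 : ℝ) < k₂ := by exact_mod_cast (show 0 < k₂ by omega)
  have h1p : 0 < 1 + p₀ := by linarith
  -- the margin δ = 1 − √2∕(1+p₀) = (1 + p₀ − √2)∕(1 + p₀)
  have hnum : 0 < 1 + p₀ - Real.sqrt 2 := by
    by_contra hneg
    have : (1 + p₀ - Real.sqrt 2) * k₂ ≤ 0 := mul_nonpos_of_nonpos_of_nonneg (not_lt.mp hneg) hk2r.le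
    linarith
  have hδ : 0 < 1 - Real.sqrt 2 / (1 + p₀) := by
    rw [show 1 - Real.sqrt 2 / (1 + p₀) = (1 + p₀ - Real.sqrt 2) / (1 + p₀) by field_simp]
    positivity
  have hδ1 : 1 - Real.sqrt 2 / (1 + p₀) ≤ 1 := by
    have : 0 ≤ Real.sqrt 2 / (1 + p₀) := by positivity
    linarith
  refine flow_nonneg_three_ages_far_middle hmono hL hb hlo hdom hh hf hg hgF hk2 hk23 hk3K hL3 hδ hδ1 ?_ (fun m => ?_) hKL hRA hKA hKAtop
    he0 hea hεt hεrec
  · -- 10 ≤ δ·k₂ ⟸ 10(1+p₀) ≤ (1+p₀−√2)k₂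
    rw [show (1 - Real.sqrt 2 / (1 + p₀)) * k₂ = ((1 + p₀ - Real.sqrt 2) * k₂) / (1 + p₀) by field_simp]
    rw [le_div_iff₀ h1p]
    linarith
  · rw [show (1 : ℝ) - (1 - Real.sqrt 2 / (1 + p₀)) = Real.sqrt 2 / (1 + p₀) by ring]
    exact pair_load_le_of_ratio hmono hL hb hlo hdom hh hf (by omega) hk23 hk3K hp0 hp m

/-- **THE CENSUS THREE AGES WITH `k₃ + 1 ≤ 19(k₂ + 1)` AND `k₂ ≥ 230`: THE END ALONG EVERY FLOW, NO DISPLAYED MARGIN** (`flow_nonneg_three_ages_middle_old`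
with `p₀ = 0.4789`: `0.4789⁴·19 ≤ 1`, `14.789 ≤ (1.4789 − 99∕70)·230`). [folklore] -/
theorem flow_nonneg_census_three_ages_ratio_le (hmono : ∀ u v : ℕ → ℝ, SeqBox γ u → SeqBox γ v → (∀ j, u j ≤ v j) → B u ≤ B v)
    (hL : ∀ k, 0 ≤ L k) (hb : 0 < b) (hlo : ∀ u, SeqBox γ u → b ≤ B u) (hdom : ∀ u, SeqBox γ u → ∑ k ∈ range K, L k * u k ≤ B u)
    (hh : SeqBox γ h) (hf : MemFlow B gIR h) (hg : ∀ t, 0 < g t ∧ g t ≤ 1)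
    (hgF : ∀ t, 1 ≤ g t * (1 + ∑ k ∈ range K, L k * h (t + k) ^ 3 / 2))
    {k₂ k₃ : ℕ} (hk2 : 230 ≤ k₂) (hk23 : k₂ < k₃) (hk3K : k₃ < K) (hratio : k₃ + 1 ≤ 19 * (k₂ + 1))
    (hL3 : ∀ j, j < K → j ≠ 1 → j ≠ k₂ → j ≠ k₃ → L j = 0)
    {N : ℕ} {KL : ℕ → ℕ → ℕ → ℝ}
    (hKL : ∀ k n l, KL k n l = if 0 < k ∧ k < K ∧ l < k then L k * h (n + k) ^ 3 / 2 * ∏ t ∈ Ico (n + 1 + l) (n + k + 1), g t else 0)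
    {KA : ℕ → ℕ → ℕ → ℝ} {RA : ℕ → (ℕ → ℝ) → ℕ → ℝ}
    (hRA : ∀ i v m, RA i v m = ∑ l ∈ range K, KA i m l * v (m + 1 + l))
    (hKA : ∀ i m l, KA i m l = KL i m l + KA (i + 1) m l) (hKAtop : ∀ m l, KA K m l = 0)
    {e ε : ℕ → ℝ} (he0 : ∀ m, 0 ≤ e m) (hea : ∀ m, e (m + 1) ≤ e m)
    (hεt : ∀ m, N < m → ε m = 0) (hεrec : ∀ m, ε m = e m - RA 1 ε m) : ∀ m, 0 ≤ ε m ∧ ε m ≤ e m := by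
  have hs99 : Real.sqrt 2 ≤ 99 / 70 := Real.sqrt_le_iff.mpr ⟨by norm_num, by norm_num⟩
  have hk2r : (230 : ℝ) ≤ k₂ := by exact_mod_cast hk2
  have hr : (k₃ : ℝ) + 1 ≤ 19 * ((k₂ : ℝ) + 1) := by exact_mod_cast hratio
  refine flow_nonneg_three_ages_middle_old hmono hL hb hlo hdom hh hf hg hgF (by omega) hk23 hk3K hL3 (p₀ := 0.4789) (by norm_num)
    ?_ ?_ hKL hRA hKA hKAtop he0 hea hεt hεrec
  · have h19 : (0.4789 : ℝ) ^ 4 * 19 ≤ 1 := by norm_num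
    have h1 : (0.4789 : ℝ) ^ 4 * ((k₃ : ℝ) + 1) ≤ (0.4789 : ℝ) ^ 4 * (19 * ((k₂ : ℝ) + 1)) := mul_le_mul_of_nonneg_left hr (by positivity)
    have h3 : ((0.4789 : ℝ) ^ 4 * 19) * ((k₂ : ℝ) + 1) ≤ 1 * ((k₂ : ℝ) + 1) := mul_le_mul_of_nonneg_right h19 (by positivity)
    linarith
  · nlinarith [mul_nonneg (sub_nonneg.2 hs99) (sub_nonneg.2 hk2r)]

/-- **WEDGE R2 DISCHARGED: THE CENSUS THREE AGES WITH A SMALL MIDDLE AGE AND A FAR OLD AGE.**  Profile carried by `{1, k₂, k₃}`, `2 ≤ k₂ < k₃ < K`;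
dampings of the self-consistent class; `p₀ ≥ 0` with `p₀⁴·(k₂+1) ≤ 2` and `10k₂·(1+p₀) ≤ (1+p₀−√2)·k₃` (so `k₂ ≤ 66`).  Then `0 ≤ ε ≤ e` at every
pin for every admissible excess and every horizon ((E91c) `flow_nonneg_three_ages_far_old` with `δ = 1 − √2∕(1+p₀)`, its hypothesis
`d + x₂ ≤ 1 − δ` served by `pair_load_le_of_ratio` for the pair `{1, k₂}`). [folklore] -/
theorem flow_nonneg_three_ages_young_pair (hmono : ∀ u v : ℕ → ℝ, SeqBox γ u → SeqBox γ v → (∀ j, u j ≤ v j) → B u ≤ B v)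
    (hL : ∀ k, 0 ≤ L k) (hb : 0 < b) (hlo : ∀ u, SeqBox γ u → b ≤ B u) (hdom : ∀ u, SeqBox γ u → ∑ k ∈ range K, L k * u k ≤ B u)
    (hh : SeqBox γ h) (hf : MemFlow B gIR h) (hg : ∀ t, 0 < g t ∧ g t ≤ 1)
    (hgF : ∀ t, 1 ≤ g t * (1 + ∑ k ∈ range K, L k * h (t + k) ^ 3 / 2))
    {k₂ k₃ : ℕ} (hk2 : 2 ≤ k₂) (hk23 : k₂ < k₃) (hk3K : k₃ < K) (hL3 : ∀ j, j < K → j ≠ 1 → j ≠ k₂ → j ≠ k₃ → L j = 0)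
    {p₀ : ℝ} (hp0 : 0 ≤ p₀) (hp : p₀ ^ 4 * ((k₂ : ℝ) + 1) ≤ 2)
    (hfar : 10 * k₂ * (1 + p₀) ≤ (1 + p₀ - Real.sqrt 2) * k₃)
    {N : ℕ} {KL : ℕ → ℕ → ℕ → ℝ}
    (hKL : ∀ k n l, KL k n l = if 0 < k ∧ k < K ∧ l < k then L k * h (n + k) ^ 3 / 2 * ∏ t ∈ Ico (n + 1 + l) (n + k + 1), g t else 0)
    {KA : ℕ → ℕ → ℕ → ℝ} {RA : ℕ → (ℕ → ℝ) → ℕ → ℝ}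
    (hRA : ∀ i v m, RA i v m = ∑ l ∈ range K, KA i m l * v (m + 1 + l))
    (hKA : ∀ i m l, KA i m l = KL i m l + KA (i + 1) m l) (hKAtop : ∀ m l, KA K m l = 0)
    {e ε : ℕ → ℝ} (he0 : ∀ m, 0 ≤ e m) (hea : ∀ m, e (m + 1) ≤ e m)
    (hεt : ∀ m, N < m → ε m = 0) (hεrec : ∀ m, ε m = e m - RA 1 ε m) : ∀ m, 0 ≤ ε m ∧ ε m ≤ e m := by
  have hs0 : 0 ≤ Real.sqrt 2 := Real.sqrt_nonneg 2
  have hk2r : (0 : ℝ) < k₂ := by exact_mod_cast (show 0 < k₂ by omega)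
  have hk3r : (0 : ℝ) < k₃ := by exact_mod_cast (show 0 < k₃ by omega)
  have h1p : 0 < 1 + p₀ := by linarith
  have hnum : 0 < 1 + p₀ - Real.sqrt 2 := by
    by_contra hneg
    have h1 : (1 + p₀ - Real.sqrt 2) * k₃ ≤ 0 := mul_nonpos_of_nonpos_of_nonneg (not_lt.mp hneg) hk3r.le
    have h2 : 0 < 10 * k₂ * (1 + p₀) := by positivity
    linarith
  have hδ : 0 < 1 - Real.sqrt 2 / (1 + p₀) := by
    rw [show 1 - Real.sqrt 2 / (1 + p₀) = (1 + p₀ - Real.sqrt 2) / (1 + p₀) by field_simp]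
    positivity
  have h2K : k₂ < K := lt_trans hk23 hk3K
  refine flow_nonneg_three_ages_far_old hmono hL hb hlo hdom hh hf hg hgF hk2 hk23 hk3K hL3 hδ ?_ (fun m => ?_) hKL hRA hKA hKAtop
    he0 hea hεt hεrec
  · -- 10k₂ ≤ δ·k₃ ⟸ 10k₂(1+p₀) ≤ (1+p₀−√2)k₃
    rw [show (1 - Real.sqrt 2 / (1 + p₀)) * k₃ = ((1 + p₀ - Real.sqrt 2) * k₃) / (1 + p₀) by field_simp]
    rw [le_div_iff₀ h1p]
    linarith
  · rw [show (1 : ℝ) - (1 - Real.sqrt 2 / (1 + p₀)) = Real.sqrt 2 / (1 + p₀) by ring]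
    have := pair_load_le_of_ratio hmono hL hb hlo hdom hh hf le_rfl (show 1 < k₂ by omega) h2K hp0 (by push_cast; linarith) m
    simpa using this

end Summit.QuantumFields.BalabanUV.Beta.EriceRemainderEnclosureHistoryAutonomyComparisonAgeCompositionPairShares

end
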